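import Literature.IUT.HodgeArakelov.AbsTopMonoidsGenuineGhatTransport
import Mathlib.FieldTheory.Galois.Profinite
import HarnessLib

/-!
# [IUTchII] Example 1.8 (vii) `(∗ĝp)` GENUINE, part 4: torsion and norms on the levels `((k̄^×)^J)^∧` of `O^ĝp(G)`
# (toolkit for the kernel clause of Remark 1.11.1 (i) (c))

S. Mochizuki, *Inter-universal Teichmüller theory II*, §1, Example 1.8 (vii) p. 40 and Remark 1.11.1 (i) (c) p. 50
("kernel given by the [`G`-linear] automorphisms … determined by the natural action of `Ẑ^×`", proof "involving the
Kummer map" = [AbsTopIII] Prop. 3.3 (ii)) [claim: Mochizuki2012, status: disputed] (IUTchII §1 Ex 1.8 (vii), kurims p.40);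
J. Neukirch, *Algebraic Number Theory*, Ch. IV §2 p. 274 (profinite completions) [cite: NeukirchANT1999, Ch. IV §2 p.274].
abc-iut cell, layer L6, row «GHATGP-GENUINE» STAGE 3a (seat abc-iut-L6-d2 gen 6; post-freeze def, reading (ii)); over
`AbsTopMonoidsGenuineGhat(Transport).lean`.

* Generic `PowCompletion` lemmas: `eq_one_of_forall_exists_pow` (`⋂_n Âⁿ = 1`), `map_injective_of` (injectivity
  criterion for `φ̂`), `exists_eq_of_of_components_mem` (FINITE DESCENT: an element all of whose components come from a
  finite set `T ⊆ A` is `η(t)`, `t ∈ T`), **`exists_eq_of_of_pow_eq_one`** (the `n`-torsion of `Â` is `η` of the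
  `n`-torsion of `A` when the latter is finite).
* Levels: `level_eq_one_of_forall_exists_pow` (`⋂_n ((k̄^×)^J)ⁿ = 1`, torus Kummer-faithfulness), `finite_level_torsion`
  (`|μ_d| ≤ d`), **`exists_torsion_exponent`** (for `J` open and `d ≥ 1` some `M ≥ 1` such that no nontrivial
  `d`-torsion element of `(k̄^×)^J` is an `M`-th power there); `exists_openNormal_le` (every open `J` contains an open
  subgroup NORMAL in `Gal(k̄/k)` — the fixing subgroup of a finite Galois subextension, Mathlib
  `InfiniteGalois.krullTopology_mem_nhds_one_iff_of_isGalois`);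
* for `N ⊴ Gal(k̄/k)` open, `N ⊆ J`: `galLevel` (the action of `Gal(k̄/k)` on the `N`-invariants), `finite_quot`
  (`J/N` finite), and **the norm `levelNorm C J N : (k̄^×)^N →* (k̄^×)^J`**, `N(a) = ∏_{σN ⊆ J} σ(a)` (`cosetRep`,
  `normFactor`, `levelNormFun`, `J`-invariance by permuting cosets).

HONEST FRAMING: classical algebra over OUR typed objects; nothing here bears on [IUTchIII] Cor. 3.12; typed ≠ proved elsewhere.
-/

set_option autoImplicit false

noncomputable section

namespace Literature.IUT.HodgeArakelov

open CategoryTheory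
open Literature.AnabelianGeometry.AbsoluteAnabelian

namespace PowCompletion

variable {A : Type} [CommGroup A] {B : Type} [CommGroup B]

/-- `⋂_n Âⁿ = 1`: an element of `Â` with `n`-th roots for every `n` is trivial (its `n`-th component is an `n`-th power
in the `n`-torsion group `A/Aⁿ`). [cite: NeukirchANT1999, Ch. IV §2 p.274] -/
theorem eq_one_of_forall_exists_pow (x : PowCompletion A) (h : ∀ n : ℕ+, ∃ y : PowCompletion A, y ^ (n : ℕ) = x) :
    x = 1 := by
  ext n
  obtain ⟨y, rfl⟩ := h n
  rw [map_pow, map_one, pow_card_eq_one]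

/-- INJECTIVITY CRITERION for `φ̂ : Â → B̂`: if for every `n` there is a multiple `N` of `n` with
`φ(a) ∈ B^N ⇒ a ∈ Aⁿ`, then `φ̂` is injective. [cite: NeukirchANT1999, Ch. IV §2 p.274] -/
theorem map_injective_of (φ : A →* B)
    (h : ∀ n : ℕ+, ∃ N : ℕ+, (n : ℕ) ∣ N ∧ ∀ a : A, φ a ∈ powSubgroup B N → a ∈ powSubgroup A n) :
    Function.Injective (map φ) := by
  refine (injective_iff_map_eq_one _).mpr fun x hx => ?_
  ext n
  obtain ⟨N, hnN, hN⟩ := h n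
  obtain ⟨a, ha⟩ := QuotientGroup.mk_surjective (component N x)
  have h1 : component N (map φ x) = 1 := by rw [hx, map_one]
  rw [component_map_mk φ x N a ha.symm, QuotientGroup.eq_one_iff] at h1
  rw [← component_compat x n N hnN, ← ha, proj_mk, map_one, QuotientGroup.eq_one_iff]
  exact hN a h1

/-- An element of `Â` all of whose components come from a FINITE set `T ⊆ A` comes from one element of `T`:
`x = η(t)` (finite descent: the nonempty finite sets `{t ∈ T | x_m = [t]}` decrease along divisibility, hence have
a common point). [cite: NeukirchANT1999, Ch. IV §2 p.274] -/
theorem exists_eq_of_of_components_mem {T : Set A} (hT : T.Finite) (x : PowCompletion A)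
    (h : ∀ m : ℕ+, ∃ t ∈ T, component m x = QuotientGroup.mk t) : ∃ t ∈ T, x = of A t := by
  classical
  -- `S m` = the elements of `T` representing the `m`-th component
  let S : ℕ+ → Set A := fun m => {t | t ∈ T ∧ component m x = QuotientGroup.mk t}
  have hSfin : ∀ m, (S m).Finite := fun m => hT.subset fun t ht => ht.1
  have hSne : ∀ m, (S m).Nonempty := fun m => by
    obtain ⟨t, ht, hx⟩ := h m
    exact ⟨t, ht, hx⟩
  have hSanti : ∀ m m' : ℕ+, (m : ℕ) ∣ m' → S m' ⊆ S m := by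
    intro m m' hmm' t ht
    refine ⟨ht.1, ?_⟩
    rw [← component_compat x m m' hmm', ht.2, proj_mk]
  -- a size-minimal `S m₀` is contained in every `S m`
  have hex : ∃ s m, (S m).ncard = s := ⟨_, 1, rfl⟩
  let s := Nat.find hex
  obtain ⟨m₀, hm₀⟩ := Nat.find_spec hex
  have hmin : ∀ m, s ≤ (S m).ncard := fun m => Nat.find_min' hex ⟨m, rfl⟩
  have hstable : ∀ m : ℕ+, S (m₀ * m) = S m₀ := by
    intro m
    exact Set.eq_of_subset_of_ncard_le (hSanti m₀ (m₀ * m) (dvd_mul_right _ _)) (by rw [hm₀]; exact hmin _)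
      (hSfin _)
  obtain ⟨t, ht⟩ := hSne m₀
  refine ⟨t, ht.1, ?_⟩
  ext m
  have htm : t ∈ S m := hSanti m (m₀ * m) (dvd_mul_left _ _) (by rw [hstable]; exact ht)
  rw [htm.2, component_of]

/-- **Torsion of `Â`**: if the `n`-torsion of `A` is finite, an `n`-torsion element of `Â` is `η(ζ)` for an
`n`-torsion `ζ ∈ A`. [cite: NeukirchANT1999, Ch. IV §2 p.274] -/
theorem exists_eq_of_of_pow_eq_one {n : ℕ+} (hfin : {a : A | a ^ (n : ℕ) = 1}.Finite) (x : PowCompletion A)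
    (hx : x ^ (n : ℕ) = 1) : ∃ ζ : A, ζ ^ (n : ℕ) = 1 ∧ x = of A ζ := by
  obtain ⟨ζ, hζ, hxζ⟩ := exists_eq_of_of_components_mem hfin x fun m => by
    -- read the `n·m`-th component: `a^n ∈ A^{nm}`, so `a = ζ·b^m` with `ζ^n = 1`
    obtain ⟨a, ha⟩ := QuotientGroup.mk_surjective (component (n * m) x)
    have h1 : component (n * m) (x ^ (n : ℕ)) = 1 := by rw [hx, map_one]
    rw [map_pow, ← ha, ← QuotientGroup.mk_pow, QuotientGroup.eq_one_iff, mem_powSubgroup_iff] at h1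
    obtain ⟨b, hb⟩ := h1
    refine ⟨a * (b ^ (m : ℕ))⁻¹, ?_, ?_⟩
    · change (a * (b ^ (m : ℕ))⁻¹) ^ (n : ℕ) = 1
      rw [mul_pow, inv_pow, ← pow_mul, ← PNat.mul_coe, mul_comm m n, hb, mul_inv_cancel]
    · rw [← component_compat x m (n * m) (dvd_mul_left _ _), ← ha, proj_mk, QuotientGroup.eq]
      -- `a⁻¹ * (a * (b^m)⁻¹) = (b⁻¹)^m ∈ A^m`
      exact mem_powSubgroup_iff.mpr ⟨b⁻¹, by rw [inv_pow]; group⟩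
  exact ⟨ζ, hζ, hxζ⟩

end PowCompletion

namespace AbsTopMonoids.Genuine

variable (C : MLFClosure.{0})

/-! ## Torus Kummer-faithfulness of the levels and the torsion exponents -/

/-- `⋂_n ((k̄^×)^J)ⁿ = 1` inside the level group `(k̄^×)^J` (`J` open): an element with `n`-th roots IN `(k̄^×)^J` for
every `n ≥ 1` is trivial. [cite: MochizukiAbsTopIII2015, Rmk 1.5.4 (i) p.33] -/
theorem level_eq_one_of_forall_exists_pow (J : OpenSubgroup (C.K ≃ₐ[C.k] C.K))
    (z : fixedUnits C (J : Subgroup (C.K ≃ₐ[C.k] C.K)))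
    (h : ∀ n : ℕ, 0 < n → ∃ t : fixedUnits C (J : Subgroup (C.K ≃ₐ[C.k] C.K)), t ^ n = z) : z = 1 := by
  have hinj := of_injective_level C ⟨J⟩
  apply hinj
  rw [map_one]
  exact (PowCompletion.of_eq_one_iff _).mpr fun n => by
    obtain ⟨t, ht⟩ := h n n.pos
    exact ⟨t, ht⟩

/-- The `d`-torsion of a level is finite (at most `d` roots of `X^d − 1` in the field `k̄`). [claim: Mochizuki2012, status: disputed] (IUTchII §1 Ex 1.8 (vii), kurims p.40) -/
theorem finite_level_torsion (J : Subgroup (C.K ≃ₐ[C.k] C.K)) (d : ℕ+) :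
    {z : fixedUnits C J | z ^ (d : ℕ) = 1}.Finite := by
  classical
  let f : fixedUnits C J → C.K := fun z => ((z : (C.K)ˣ) : C.K)
  have hf : Function.Injective f := fun z w h => Subtype.ext (Units.ext h)
  refine ((Polynomial.nthRootsFinset (d : ℕ) (1 : C.K)).finite_toSet.preimage hf.injOn).subset fun z hz => ?_
  change f z ∈ (↑(Polynomial.nthRootsFinset (d : ℕ) (1 : C.K)) : Set C.K)
  rw [Finset.mem_coe, Polynomial.mem_nthRootsFinset d.pos]
  have := congrArg (fun w : fixedUnits C J => ((w : (C.K)ˣ) : C.K)) hz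
  simpa [f] using this

/-- **Torsion exponent of a level**: for `J` open and `d ≥ 1` there is `M ≥ 1` such that NO nontrivial `d`-torsion
element of `(k̄^×)^J` is an `M`-th power in `(k̄^×)^J` (each of the finitely many `ζ ≠ 1` fails to be infinitely
divisible by torus Kummer-faithfulness; take a common multiple). [cite: MochizukiAbsTopIII2015, Rmk 1.5.4 (i) p.33] -/
theorem exists_torsion_exponent (J : OpenSubgroup (C.K ≃ₐ[C.k] C.K)) (d : ℕ+) :
    ∃ M : ℕ+, ∀ z : fixedUnits C (J : Subgroup (C.K ≃ₐ[C.k] C.K)), z ^ (d : ℕ) = 1 →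
      (∃ t : fixedUnits C (J : Subgroup (C.K ≃ₐ[C.k] C.K)), t ^ (M : ℕ) = z) → z = 1 := by
  classical
  -- every `ζ ≠ 1` with `ζ^d = 1` has SOME exponent `m ≥ 1` at which it is not a power
  have key : ∀ z : fixedUnits C (J : Subgroup (C.K ≃ₐ[C.k] C.K)), z ≠ 1 →
      ∃ m : ℕ+, ¬ ∃ t : fixedUnits C (J : Subgroup (C.K ≃ₐ[C.k] C.K)), t ^ (m : ℕ) = z := by
    intro z hz
    by_contra hcon
    push Not at hcon
    exact hz (level_eq_one_of_forall_exists_pow C J z fun n hn => hcon ⟨n, hn⟩)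
  let T := (finite_level_torsion C (J : Subgroup (C.K ≃ₐ[C.k] C.K)) d).toFinset
  let m : fixedUnits C (J : Subgroup (C.K ≃ₐ[C.k] C.K)) → ℕ+ := fun z =>
    if hz : z ≠ 1 then (key z hz).choose else 1
  refine ⟨⟨T.prod fun w => ((m w : ℕ+) : ℕ), Finset.prod_pos fun w _ => (m w).pos⟩, fun z hzd ⟨t, ht⟩ => ?_⟩
  by_contra hz
  have hzT : z ∈ T := by simpa [T] using hzd
  have hm : ¬ ∃ t : fixedUnits C (J : Subgroup (C.K ≃ₐ[C.k] C.K)), t ^ ((m z : ℕ+) : ℕ) = z := by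
    simp only [m, dif_pos hz]
    exact (key z hz).choose_spec
  apply hm
  obtain ⟨c, hc⟩ : ((m z : ℕ+) : ℕ) ∣ T.prod fun w => ((m w : ℕ+) : ℕ) :=
    Finset.dvd_prod_of_mem (fun w => ((m w : ℕ+) : ℕ)) hzT
  refine ⟨t ^ c, ?_⟩
  rw [← pow_mul, mul_comm, ← hc]
  exact ht

/-! ## Open NORMAL refinements of the levels -/

/-- Every open subgroup of `Gal(k̄/k)` contains an open subgroup that is NORMAL in `Gal(k̄/k)` (the fixing subgroup
of a finite Galois subextension: Krull topology). [claim: Mochizuki2012, status: disputed] (IUTchII §1 Ex 1.8 (vii), kurims p.40) -/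
theorem exists_openNormal_le (J : OpenSubgroup (C.K ≃ₐ[C.k] C.K)) :
    ∃ N : OpenSubgroup (C.K ≃ₐ[C.k] C.K), (N : Subgroup (C.K ≃ₐ[C.k] C.K)) ≤ J ∧ (N : Subgroup (C.K ≃ₐ[C.k] C.K)).Normal := by
  haveI : IsGalois C.k C.K := {}
  obtain ⟨L, hL⟩ := (InfiniteGalois.krullTopology_mem_nhds_one_iff_of_isGalois (k := C.k) (K := C.K) (J : Set (C.K ≃ₐ[C.k] C.K))).mp
    (J.isOpen.mem_nhds J.one_mem)
  refine ⟨⟨L.fixingSubgroup, IntermediateField.fixingSubgroup_isOpen L.toIntermediateField⟩, fun σ hσ => hL hσ, ?_⟩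
  change L.toIntermediateField.fixingSubgroup.Normal
  infer_instance

/-! ## The norm `N_{J/N} : (k̄^×)^N → (k̄^×)^J` for `N ⊴ Gal(k̄/k)` open, `N ⊆ J` -/

section Norm

variable (J N : OpenSubgroup (C.K ≃ₐ[C.k] C.K)) (hle : (N : Subgroup (C.K ≃ₐ[C.k] C.K)) ≤ J)
  [hN : (N : Subgroup (C.K ≃ₐ[C.k] C.K)).Normal]

/-- `σ ∈ Gal(k̄/k)` acts on the `N`-invariants for `N` normal. [claim: Mochizuki2012, status: disputed] (IUTchII §1 Ex 1.8 (vii), kurims p.40) -/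
def galLevel (σ : C.K ≃ₐ[C.k] C.K) :
    fixedUnits C (N : Subgroup (C.K ≃ₐ[C.k] C.K)) →* fixedUnits C (N : Subgroup (C.K ≃ₐ[C.k] C.K)) where
  toFun a := ⟨galUnits C σ a, fun τ hτ => by
    have h : σ⁻¹ * τ * σ ∈ (N : Subgroup (C.K ≃ₐ[C.k] C.K)) := by
      have := hN.conj_mem τ hτ σ⁻¹
      simpa using this
    have ha := a.2 _ h
    change (σ⁻¹ * τ * σ) (a : (C.K)ˣ) = _ at ha
    change τ (σ ((a : (C.K)ˣ) : C.K)) = σ ((a : (C.K)ˣ) : C.K)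
    have : σ ((σ⁻¹ * τ * σ) ((a : (C.K)ˣ) : C.K)) = σ ((a : (C.K)ˣ) : C.K) := by rw [ha]
    simpa [AlgEquiv.mul_apply, AlgEquiv.aut_inv] using this⟩
  map_one' := Subtype.ext (by simp)
  map_mul' _ _ := Subtype.ext (by simp)

/-- `coe_galLevel` (structure lemma of the genuine `(∗ĝp)` levels). [claim: Mochizuki2012, status: disputed] (IUTchII §1 Ex 1.8 (vii), kurims p.40) -/
@[simp] theorem coe_galLevel (σ : C.K ≃ₐ[C.k] C.K) (b : fixedUnits C (N : Subgroup (C.K ≃ₐ[C.k] C.K))) :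
    (((galLevel C N σ b : fixedUnits C _) : (C.K)ˣ) : C.K) = σ ((b : (C.K)ˣ) : C.K) := rfl

/-- `galLevel_mul` (structure lemma of the genuine `(∗ĝp)` levels). [claim: Mochizuki2012, status: disputed] (IUTchII §1 Ex 1.8 (vii), kurims p.40) -/
theorem galLevel_mul (σ τ : C.K ≃ₐ[C.k] C.K) : galLevel C N (σ * τ) = (galLevel C N σ).comp (galLevel C N τ) :=
  MonoidHom.ext fun _ => Subtype.ext (Units.ext rfl)

/-- `galLevel_eq_self_of_mem` (structure lemma of the genuine `(∗ĝp)` levels). [claim: Mochizuki2012, status: disputed] (IUTchII §1 Ex 1.8 (vii), kurims p.40) -/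
theorem galLevel_eq_self_of_mem (τ : C.K ≃ₐ[C.k] C.K) (hτ : τ ∈ (N : Subgroup (C.K ≃ₐ[C.k] C.K)))
    (b : fixedUnits C (N : Subgroup (C.K ≃ₐ[C.k] C.K))) : galLevel C N τ b = b :=
  Subtype.ext (Units.ext (b.2 τ hτ))

omit hN in
/-- The quotient `J/N` is finite (`N` open in the compact group `Gal(k̄/k)`). [claim: Mochizuki2012, status: disputed] (IUTchII §1 Ex 1.8 (vii), kurims p.40) -/
theorem finite_quot : Finite (↥(J : Subgroup (C.K ≃ₐ[C.k] C.K)) ⧸ ((N : Subgroup (C.K ≃ₐ[C.k] C.K)).subgroupOf J)) := by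
  haveI : IsGalois C.k C.K := {}
  exact Subgroup.quotient_finite_of_isOpen' (J : Subgroup (C.K ≃ₐ[C.k] C.K)) _ J.isOpen
    (N.isOpen.preimage continuous_subtype_val)

/-- The action of a coset `σN ⊆ J` on the `N`-invariants (well defined: `N` acts trivially). [claim: Mochizuki2012, status: disputed] (IUTchII §1 Ex 1.8 (vii), kurims p.40) -/
theorem galLevel_eq_of_quotient_eq {σ τ : ↥(J : Subgroup (C.K ≃ₐ[C.k] C.K))}
    (h : (QuotientGroup.mk σ : ↥(J : Subgroup (C.K ≃ₐ[C.k] C.K)) ⧸ ((N : Subgroup (C.K ≃ₐ[C.k] C.K)).subgroupOf J)) = QuotientGroup.mk τ)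
    (a : fixedUnits C (N : Subgroup (C.K ≃ₐ[C.k] C.K))) : galLevel C N (σ : C.K ≃ₐ[C.k] C.K) a = galLevel C N (τ : C.K ≃ₐ[C.k] C.K) a := by
  rw [QuotientGroup.eq] at h
  have hmem : ((σ : C.K ≃ₐ[C.k] C.K))⁻¹ * (τ : C.K ≃ₐ[C.k] C.K) ∈ (N : Subgroup (C.K ≃ₐ[C.k] C.K)) := by
    simpa [Subgroup.mem_subgroupOf] using h
  have : galLevel C N (τ : C.K ≃ₐ[C.k] C.K) a =
      galLevel C N (σ : C.K ≃ₐ[C.k] C.K) (galLevel C N (((σ : C.K ≃ₐ[C.k] C.K))⁻¹ * (τ : C.K ≃ₐ[C.k] C.K)) a) := by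
    rw [← MonoidHom.comp_apply, ← galLevel_mul, mul_inv_cancel_left]
  rw [this, galLevel_eq_self_of_mem C N _ hmem]

/-- A representative `σ_q ∈ J` of the coset `q ∈ J/N`. [claim: Mochizuki2012, status: disputed] (IUTchII §1 Ex 1.8 (vii), kurims p.40) -/
def cosetRep (q : ↥(J : Subgroup (C.K ≃ₐ[C.k] C.K)) ⧸ ((N : Subgroup (C.K ≃ₐ[C.k] C.K)).subgroupOf J)) :
    C.K ≃ₐ[C.k] C.K :=
  ((Quotient.out q : ↥(J : Subgroup (C.K ≃ₐ[C.k] C.K))) : C.K ≃ₐ[C.k] C.K)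

/-- The factor `σ_q(a) ∈ k̄^×` of the norm. [claim: Mochizuki2012, status: disputed] (IUTchII §1 Ex 1.8 (vii), kurims p.40) -/
def normFactor (a : fixedUnits C (N : Subgroup (C.K ≃ₐ[C.k] C.K)))
    (q : ↥(J : Subgroup (C.K ≃ₐ[C.k] C.K)) ⧸ ((N : Subgroup (C.K ≃ₐ[C.k] C.K)).subgroupOf J)) : (C.K)ˣ :=
  (↑(galLevel C N (cosetRep C J N q) a) : (C.K)ˣ)

/-- `ρ ∈ J` carries the factor at `q` to the factor at `ρ • q`. [claim: Mochizuki2012, status: disputed] (IUTchII §1 Ex 1.8 (vii), kurims p.40) -/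
theorem galUnits_normFactor (a : fixedUnits C (N : Subgroup (C.K ≃ₐ[C.k] C.K))) (ρ : ↥(J : Subgroup (C.K ≃ₐ[C.k] C.K)))
    (q : ↥(J : Subgroup (C.K ≃ₐ[C.k] C.K)) ⧸ ((N : Subgroup (C.K ≃ₐ[C.k] C.K)).subgroupOf J)) :
    galUnits C (ρ : C.K ≃ₐ[C.k] C.K) (normFactor C J N a q) = normFactor C J N a (ρ • q) := by
  change (↑(galLevel C N (ρ : C.K ≃ₐ[C.k] C.K) (galLevel C N (cosetRep C J N q) a)) : (C.K)ˣ) = _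
  rw [← MonoidHom.comp_apply, ← galLevel_mul]
  change (↑(galLevel C N (((ρ * Quotient.out q : ↥(J : Subgroup (C.K ≃ₐ[C.k] C.K))) : C.K ≃ₐ[C.k] C.K)) a) : (C.K)ˣ) =
    (↑(galLevel C N (cosetRep C J N (ρ • q)) a) : (C.K)ˣ)
  refine congrArg Subtype.val (galLevel_eq_of_quotient_eq C J N ?_ a)
  change (QuotientGroup.mk (ρ • Quotient.out q) : _ ⧸ _) = QuotientGroup.mk (Quotient.out (ρ • q))
  rw [← MulAction.Quotient.smul_mk, QuotientGroup.out_eq', QuotientGroup.out_eq']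

/-- The underlying unit of the norm: `∏_{q ∈ J/N} σ_q(a)` for chosen coset representatives `σ_q`. [claim: Mochizuki2012, status: disputed] (IUTchII §1 Ex 1.8 (vii), kurims p.40) -/
def levelNormFun (a : fixedUnits C (N : Subgroup (C.K ≃ₐ[C.k] C.K))) : (C.K)ˣ :=
  haveI := finite_quot C J N
  haveI := Fintype.ofFinite (↥(J : Subgroup (C.K ≃ₐ[C.k] C.K)) ⧸ ((N : Subgroup (C.K ≃ₐ[C.k] C.K)).subgroupOf J))
  ∏ q : ↥(J : Subgroup (C.K ≃ₐ[C.k] C.K)) ⧸ ((N : Subgroup (C.K ≃ₐ[C.k] C.K)).subgroupOf J), normFactor C J N a q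

/-- The norm is `J`-invariant (`ρ ∈ J` permutes the cosets `J/N`). [claim: Mochizuki2012, status: disputed] (IUTchII §1 Ex 1.8 (vii), kurims p.40) -/
theorem levelNormFun_mem (a : fixedUnits C (N : Subgroup (C.K ≃ₐ[C.k] C.K))) :
    levelNormFun C J N a ∈ fixedUnits C (J : Subgroup (C.K ≃ₐ[C.k] C.K)) := by
  classical
  haveI := finite_quot C J N
  letI := Fintype.ofFinite (↥(J : Subgroup (C.K ≃ₐ[C.k] C.K)) ⧸ ((N : Subgroup (C.K ≃ₐ[C.k] C.K)).subgroupOf J))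
  intro ρ hρ
  let ρ' : ↥(J : Subgroup (C.K ≃ₐ[C.k] C.K)) := ⟨ρ, hρ⟩
  have h1 : galUnits C ρ (levelNormFun C J N a) = levelNormFun C J N a := by
    change galUnits C (ρ' : C.K ≃ₐ[C.k] C.K) (∏ q, normFactor C J N a q) = ∏ q, normFactor C J N a q
    rw [map_prod]
    simp_rw [galUnits_normFactor]
    exact Fintype.prod_equiv (MulAction.toPerm ρ') (fun q => normFactor C J N a (ρ' • q)) _ fun q => rfl
  exact congrArg (fun w : (C.K)ˣ => (w : C.K)) h1

/-- **The norm `N_{J/N}(a) := ∏_{σN ⊆ J} σ(a)`** on the `N`-invariant units, valued in the `J`-invariant units.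
[cite: NeukirchANT1999, Ch. IV §2 p.274] -/
def levelNorm : fixedUnits C (N : Subgroup (C.K ≃ₐ[C.k] C.K)) →* fixedUnits C (J : Subgroup (C.K ≃ₐ[C.k] C.K)) where
  toFun a := ⟨levelNormFun C J N a, levelNormFun_mem C J N a⟩
  map_one' := Subtype.ext (by simp [levelNormFun, normFactor])
  map_mul' a b := Subtype.ext (by simp [levelNormFun, normFactor, Finset.prod_mul_distrib])

end Norm

end AbsTopMonoids.Genuine

end Literature.IUT.HodgeArakelov

end
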